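import Literature.MathematicalPhysics.QuantumLattice.PairFieldCommutatorLocality
import HarnessLib

/-!
# Locality of the commutator of two translation sums: `‖⟨ψ, [𝒜, 𝒞] ψ⟩‖ ≤ C·L^d`

Topic `MathematicalPhysics/QuantumLattice`; namespace `Literature.MathematicalPhysics.QuantumLattice`.
For an EVEN local operator `A ∈ 𝔄_{Λ_A}` and any local operator `C ∈ 𝔄_{Λ_C}` of the lattice fermion
algebra of `ℤ^d`, the translation sums `𝒜 = Σ_v T_v Γ_L(A)`, `𝒞 = Σ_w T_w Γ_L(C)` on the torus `(ℤ/Lℤ)^d`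
have a commutator whose expectation in every unit vector is `O(L^d)` — uniformly in the state and in the
side `L ≥ L₀` (`exists_norm_expect_commutator_sum_translate_le`). This is the tree's
`expect_commutator_sum_relabel_translate` (the commutator is the translation sum of the local density
`commDensity`) read through the crude entrywise bound `norm_torusAvgExpectAt_le_sum_norm`; the pair-field
instance is `exists_norm_expect_commutator_pairField_le` (PairFieldCommutatorLocality), whose proof this file
copies with `A`, `C` general.

Use (hubbard-obs OP1-C tier, MENU3-TLPINCER §7.4 (iii)): for a charge-`q` word `W` (`[N̂, W] = −qW`) the
double commutators of its Hermitian parts with the particle number reduce to `[W, W†]`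
(`[B₁,[B₁,N̂]] = [B₂,[B₂,N̂]] = (q/2)[W, W†]`-type identities), so the `N̂`-part of the Pusz–Woronowicz
constant of `K = H − μN̂` is `O(L^d)` by this lemma. Everything is PROVED; no definition, no named fact.

## References

* O. Bratteli, D. W. Robinson, *Operator Algebras and Quantum Statistical Mechanics 2*, 2nd ed. (Springer,
  1997), §6.2.1 (translation-invariant finite-range interactions; commutators of local sums). [BratteliRobinsonII1997]
-/

noncomputable section

namespace Literature.MathematicalPhysics.QuantumLattice

open Matrix Finset HubbardWave0 Literature.Probability.LatticeModels
open scoped ComplexOrder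

/-- **`‖⟨ψ, (𝒜𝒞 − 𝒞𝒜) ψ⟩‖ ≤ C·L^d` uniformly in the unit vector `ψ` and the side `L ≥ L₀`**, for the
translation sums `𝒜 = Σ_v T_v Γ_L(A)`, `𝒞 = Σ_w T_w Γ_L(C)` of an even local `A` and any local `C`: the
commutator is the translation sum of the local density `Σ_z [τ_z A, C]` over the finitely many offsets at
which the supports meet, whose expectation per site is an averaged torus expectation of a fixed local
matrix. [cite: BratteliRobinsonII1997, §6.2.1] -/
theorem exists_norm_expect_commutator_sum_translate_le {d : ℕ} {ΛA ΛC : Finset (Site d)}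
    {A : FermionOp ΛA} (hAeven : A ∈ carEvenSubalgebra (Finset.univ : Finset (Orb (PolySite ΛA))))
    (C : FermionOp ΛC) :
    ∃ Cst : ℝ, ∃ L₀ : ℕ, 0 ≤ Cst ∧ ∀ (L : ℕ) [NeZero L], L₀ ≤ L →
      ∀ (hA : Set.InjOn (Torus.proj (d := d) L) ↑ΛA) (hC : Set.InjOn (Torus.proj (d := d) L) ↑ΛC)
        (ψ : Fock (Orb (FermionTorus d L))), star ψ ⬝ᵥ ψ = 1 →
        ‖expect ((∑ v : TorusSite d L, relabel (Orb.translate v) (fermionEmbed (PolySite.toTorusEmb L hA) A)) *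
              (∑ w : TorusSite d L, relabel (Orb.translate w) (fermionEmbed (PolySite.toTorusEmb L hC) C)) -
            (∑ w : TorusSite d L, relabel (Orb.translate w) (fermionEmbed (PolySite.toTorusEmb L hC) C)) *
              (∑ v : TorusSite d L, relabel (Orb.translate v) (fermionEmbed (PolySite.toTorusEmb L hA) A)))
            ψ‖ ≤ Cst * (L : ℝ) ^ d := by
  -- regions
  set Z : Finset (Site d) := (ΛC ×ˢ ΛA).image (fun p => p.1 - p.2) with hZ
  set Ω : Finset (Site d) := (ΛA ∪ ΛC) ∪ Z.biUnion (fun z => shiftSet z ΛA) with hΩ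
  have hAΩ : ΛA ⊆ Ω := Finset.subset_union_left.trans Finset.subset_union_left
  have hCΩ : ΛC ⊆ Ω := Finset.subset_union_right.trans Finset.subset_union_left
  have hZΩ : ∀ z ∈ Z, shiftSet z ΛA ⊆ Ω := fun z hz =>
    (Finset.subset_biUnion_of_mem (fun z => shiftSet z ΛA) hz).trans Finset.subset_union_right
  have hcomplete : ∀ a ∈ ΛA, ∀ c ∈ ΛC, c - a ∈ Z := fun a ha c hc =>
    Finset.mem_image.2 ⟨(c, a), Finset.mem_product.2 ⟨hc, ha⟩, rfl⟩
  set D : FermionOp Ω := commDensity Ω Z hCΩ A C with hDdef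
  -- the constant and the threshold
  obtain ⟨L₁, hL₁⟩ := exists_forall_le_injOn_proj Ω
  obtain ⟨L₂, hL₂⟩ := exists_forall_le_injOn_proj Z
  refine ⟨∑ s, ∑ t, ‖D s t‖, max L₁ L₂, Finset.sum_nonneg fun s _ => Finset.sum_nonneg fun t _ => norm_nonneg _,
    fun L _ hL hA hC ψ hψ => ?_⟩
  have hΩinj : Set.InjOn (Torus.proj (d := d) L) ↑Ω := hL₁ L (le_trans (le_max_left _ _) hL)
  have hZinj : Set.InjOn (Torus.proj (d := d) L) ↑Z := hL₂ L (le_trans (le_max_right _ _) hL)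
  have key := expect_commutator_sum_relabel_translate L hΩinj hZinj hAΩ hCΩ hZΩ hcomplete hAeven C ψ
  rw [key, norm_mul, norm_pow, Complex.norm_natCast, mul_comm]
  exact mul_le_mul_of_nonneg_right (norm_torusAvgExpectAt_le_sum_norm L Ω D hψ) (by positivity)

/-- Real-part form: `|Re⟨ψ, (𝒜𝒞 − 𝒞𝒜) ψ⟩| ≤ C·L^d`. [cite: BratteliRobinsonII1997, §6.2.1] -/
theorem exists_abs_re_expect_commutator_sum_translate_le {d : ℕ} {ΛA ΛC : Finset (Site d)}
    {A : FermionOp ΛA} (hAeven : A ∈ carEvenSubalgebra (Finset.univ : Finset (Orb (PolySite ΛA))))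
    (C : FermionOp ΛC) :
    ∃ Cst : ℝ, ∃ L₀ : ℕ, 0 ≤ Cst ∧ ∀ (L : ℕ) [NeZero L], L₀ ≤ L →
      ∀ (hA : Set.InjOn (Torus.proj (d := d) L) ↑ΛA) (hC : Set.InjOn (Torus.proj (d := d) L) ↑ΛC)
        (ψ : Fock (Orb (FermionTorus d L))), star ψ ⬝ᵥ ψ = 1 →
        |(expect ((∑ v : TorusSite d L, relabel (Orb.translate v) (fermionEmbed (PolySite.toTorusEmb L hA) A)) *
              (∑ w : TorusSite d L, relabel (Orb.translate w) (fermionEmbed (PolySite.toTorusEmb L hC) C)) -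
            (∑ w : TorusSite d L, relabel (Orb.translate w) (fermionEmbed (PolySite.toTorusEmb L hC) C)) *
              (∑ v : TorusSite d L, relabel (Orb.translate v) (fermionEmbed (PolySite.toTorusEmb L hA) A)))
            ψ).re| ≤ Cst * (L : ℝ) ^ d := by
  obtain ⟨Cst, L₀, hCst, h⟩ := exists_norm_expect_commutator_sum_translate_le hAeven C
  exact ⟨Cst, L₀, hCst, fun L _ hL hA hC ψ hψ => (Complex.abs_re_le_norm _).trans (h L hL hA hC ψ hψ)⟩

end Literature.MathematicalPhysics.QuantumLattice

end
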